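import Literature.AlgebraicGeometry.Frobenioids.ArithmeticRealificationOrderCompat
import HarnessLib

/-!
# Frobenioids I, Theorem 6.4 (ii): uniformity of `deg(Ψ^rlf)` from ONE scaled transport — the per-pair form of
# sub-DAG row T64ii/L04 (piece E2), for chaining along the connected base

Mochizuki, *The geometry of Frobenioids I: the general theory*, Kyushu J. Math. **62** (2008) 293–400, §6,
Theorem 6.4 (ii), kurims text p. 114 ("there exists an element `deg(Ψ^rlf) ∈ ℝ_{>0}` such that for all
Frobenius-trivial `A₁ ∈ Ob(C₁)`, `A₂ ∈ Ob(C₂)` such that `A₂ = Ψ^rlf(A₁)` … the composite of `δ_{A₂}` with the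
isomorphism `Pic_Φ(A₁) ⥲ Pic_Φ(A₂)` determined by `Ψ^rlf` … is equal to `deg(Ψ^rlf) · δ_{A₁}`") and Example 6.3
p. 113 (the monoid `Φ` on the CONNECTED base `D`, pull-backs along its morphisms) [cite: MochizukiFrdI2008, Thm. 6.4 (ii) p.114].

PROOF-ONLY (cell abc-iut, sub-DAG `plan/L1/SUBDAG-FrdI-Thm64.md` row **T64ii/L04**; seat abc-iut-L1-d2, row E4 «δ at THE
instance», as a service to the (E) assembly of abc-iut-w4-d086 / piece E2 of abc-iut-w5-d137).  Abc-iut-w5-d137's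
`Thm64ii_L04_uniform_of_scaledNaturality` (`ArithmeticRealificationScaledNaturality.lean`) asks for scaled transports
`τ` between EVERY pair of Frobenius-trivial objects, with a NATURAL-NUMBER factor `c`.  At THE realified arithmetic
Frobenioids such transports exist for base-COMPARABLE pairs only (`Pic(f)` along `f : Base A ⟶ Base B`, factor
`[L_A : L_B]`: abc-iut-L1-d2's `arithRealification_δ_picPull` / `arithRealification_picPull_bijective`); an arbitrary
pair is linked through a common over-object (compositum) and the conclusion — an EQUALITY of the composites
`δ_{ΨA} ∘ picMap_A ∘ δ_A⁻¹` — is then chained by transitivity.  This file therefore records the PER-PAIR form of that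
seat's argument (same two-line proof: additivity gives `c · φ_A(t/c) = φ_A(t)`):
* `Thm64ii_L04_eq_of_scaledTransport` — ONE scaled transport between `A` and `B` ⇒ `φ_A = φ_B`;
* `Thm64ii_L04_eq_of_common_refinement` — transports `A ⇝ C`, `B ⇝ C` ⇒ `φ_A = φ_B`.
Nothing here is specific to the abc programme or bears on [IUTchIII] Cor. 3.12; classical order/algebra.
-/

noncomputable section

namespace Literature.AlgebraicGeometry.Frobenioids

open CategoryTheory

universe u v

variable {F₁ : Type} [Field F₁] {K₁ : Type} [Field K₁] [Algebra F₁ K₁]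
variable {F₂ : Type} [Field F₂] {K₂ : Type} [Field K₂] [Algebra F₂ K₂]
variable {Rlf₁ : Type u} [Category.{v} Rlf₁] {Rlf₂ : Type u} [Category.{v} Rlf₂]
variable (R₁ : ArithRealification (F := F₁) (K := K₁) Rlf₁) (R₂ : ArithRealification (F := F₂) (K := K₂) Rlf₂)

/-- An additive map `φ : ℝ → ℝ` satisfies `c · φ (t / c) = φ t` for every natural number `c ≥ 1` (additivity only).
[cite: MochizukiFrdI2008, Thm. 6.4 (ii) p.114] -/
theorem natCast_mul_addMonoidHom_div_natCast (φ : ℝ →+ ℝ) {c : ℕ} (hc : 0 < c) (t : ℝ) :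
    (c : ℝ) * φ (t / c) = φ t := by
  have hc' : (c : ℝ) ≠ 0 := Nat.cast_ne_zero.mpr (Nat.pos_iff_ne_zero.mp hc)
  rw [← nsmul_eq_mul, ← map_nsmul, nsmul_eq_mul, mul_div_cancel₀ t hc']

/-- **T64ii/L04, per-pair form.** ONE scaled transport between the Frobenius-trivial objects `A` and `B` — additive
isomorphisms `τ₁ : Pic_Φ(A) ⥲ Pic_Φ(B)`, `τ₂ : Pic_Φ(ΨA) ⥲ Pic_Φ(ΨB)` intertwining `picMap` and scaling the degree
maps by the SAME natural number `c ≥ 1` (`δ_B ∘ τ₁ = c · δ_A`, `δ_{ΨB} ∘ τ₂ = c · δ_{ΨA}`; e.g. the pull-backs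
`Pic(f)` along a base morphism, `c = [L_B : L_A]`) — forces the composites `δ_{ΨA} ∘ picMap_A ∘ δ_A⁻¹` and
`δ_{ΨB} ∘ picMap_B ∘ δ_B⁻¹` to coincide. [cite: MochizukiFrdI2008, Thm. 6.4 (ii) p.114] -/
theorem Thm64ii_L04_eq_of_scaledTransport (Ψ : Rlf₁ ≌ Rlf₂)
    (picMap : ∀ A : Rlf₁, R₁.Pic A ≃+ R₂.Pic (Ψ.functor.obj A))
    {A B : Rlf₁} (hA : R₁.ops.IsFrobeniusTrivial A) (hA' : R₂.ops.IsFrobeniusTrivial (Ψ.functor.obj A))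
    (hB : R₁.ops.IsFrobeniusTrivial B) (hB' : R₂.ops.IsFrobeniusTrivial (Ψ.functor.obj B))
    {c : ℕ} (hc : 0 < c) (τ₁ : R₁.Pic A ≃+ R₁.Pic B) (τ₂ : R₂.Pic (Ψ.functor.obj A) ≃+ R₂.Pic (Ψ.functor.obj B))
    (hδ₁ : ∀ x, R₁.δ B hB (τ₁ x) = c * R₁.δ A hA x) (hδ₂ : ∀ y, R₂.δ _ hB' (τ₂ y) = c * R₂.δ _ hA' y)
    (hpm : ∀ x, picMap B (τ₁ x) = τ₂ (picMap A x)) (t : ℝ) :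
    R₂.δ _ hA' (picMap A ((R₁.δ A hA).symm t)) = R₂.δ _ hB' (picMap B ((R₁.δ B hB).symm t)) := by
  have hc' : (c : ℝ) ≠ 0 := Nat.cast_ne_zero.mpr (Nat.pos_iff_ne_zero.mp hc)
  -- the composite `φ_A : t ↦ δ_{ΨA}(picMap_A(δ_A⁻¹ t))` as an additive homomorphism
  let φA : ℝ →+ ℝ :=
    (R₂.δ _ hA').toAddMonoidHom.comp ((picMap A).toAddMonoidHom.comp (R₁.δ A hA).symm.toAddMonoidHom)
  have hφA : ∀ s, φA s = R₂.δ _ hA' (picMap A ((R₁.δ A hA).symm s)) := fun _ => rfl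
  -- `δ_B⁻¹ t = τ₁ (δ_A⁻¹ (t / c))` since `δ_B ∘ τ₁ = c · δ_A`
  have h1 : (R₁.δ B hB).symm t = τ₁ ((R₁.δ A hA).symm (t / c)) := by
    apply (R₁.δ B hB).injective
    rw [(R₁.δ B hB).apply_symm_apply, hδ₁, (R₁.δ A hA).apply_symm_apply, mul_div_cancel₀ t hc']
  rw [h1, hpm, hδ₂, ← hφA, ← hφA, natCast_mul_addMonoidHom_div_natCast φA hc t]

/-- **T64ii/L04 through a common refinement.** If `A` and `B` are each linked to a third Frobenius-trivial object
`C` by a scaled transport (the connected base: both `Base A`, `Base B` map to a compositum), then the composites for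
`A` and `B` coincide. [cite: MochizukiFrdI2008, Thm. 6.4 (ii) p.114] -/
theorem Thm64ii_L04_eq_of_common_refinement (Ψ : Rlf₁ ≌ Rlf₂)
    (picMap : ∀ A : Rlf₁, R₁.Pic A ≃+ R₂.Pic (Ψ.functor.obj A))
    {A B C : Rlf₁} (hA : R₁.ops.IsFrobeniusTrivial A) (hA' : R₂.ops.IsFrobeniusTrivial (Ψ.functor.obj A))
    (hB : R₁.ops.IsFrobeniusTrivial B) (hB' : R₂.ops.IsFrobeniusTrivial (Ψ.functor.obj B))
    (hC : R₁.ops.IsFrobeniusTrivial C) (hC' : R₂.ops.IsFrobeniusTrivial (Ψ.functor.obj C))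
    {a : ℕ} (ha : 0 < a) (σ₁ : R₁.Pic A ≃+ R₁.Pic C) (σ₂ : R₂.Pic (Ψ.functor.obj A) ≃+ R₂.Pic (Ψ.functor.obj C))
    (hσ₁ : ∀ x, R₁.δ C hC (σ₁ x) = a * R₁.δ A hA x) (hσ₂ : ∀ y, R₂.δ _ hC' (σ₂ y) = a * R₂.δ _ hA' y)
    (hσ : ∀ x, picMap C (σ₁ x) = σ₂ (picMap A x))
    {b : ℕ} (hb : 0 < b) (τ₁ : R₁.Pic B ≃+ R₁.Pic C) (τ₂ : R₂.Pic (Ψ.functor.obj B) ≃+ R₂.Pic (Ψ.functor.obj C))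
    (hτ₁ : ∀ x, R₁.δ C hC (τ₁ x) = b * R₁.δ B hB x) (hτ₂ : ∀ y, R₂.δ _ hC' (τ₂ y) = b * R₂.δ _ hB' y)
    (hτ : ∀ x, picMap C (τ₁ x) = τ₂ (picMap B x)) (t : ℝ) :
    R₂.δ _ hA' (picMap A ((R₁.δ A hA).symm t)) = R₂.δ _ hB' (picMap B ((R₁.δ B hB).symm t)) :=
  (Thm64ii_L04_eq_of_scaledTransport R₁ R₂ Ψ picMap hA hA' hC hC' ha σ₁ σ₂ hσ₁ hσ₂ hσ t).trans
    (Thm64ii_L04_eq_of_scaledTransport R₁ R₂ Ψ picMap hB hB' hC hC' hb τ₁ τ₂ hτ₁ hτ₂ hτ t).symm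

end Literature.AlgebraicGeometry.Frobenioids

end
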